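import Summits.AnomalousDissipation.AnomalousDissipation.Theses.RuelleSaturation

/-!
# Birth skeleton for piece Fl = `FloorEternalisation` (split child 3/3 of KolmogorovHorizonChaos; support)

Two named stubs and the kernel-checked `FloorEternalisation_of`:
* `stub_goodShiftedWitnesses` — TILING LEMMA + bookkeeping: from window witnesses with FTLE floor `a·L`
  for all `L ≥ L₀`, for every `n` a witness on a long window and a LATE START `s ≥ n` (with room
  `s + 2n + 2 ≤ L`) from which ALL windows of lengths `1, 2, …, n+1` have FTLE mean `≥ a/2`
  (else tile `[n, L−n−(n+1)]` by bad windows: `(1/2)·a·L < β̄(2n + n + 1)`-type contradiction for `L` large);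
* `stub_eternalLimitOfShifts` — COMPACTNESS: such shifted witnesses (budget `B` uniform) have a
  `C^∞_loc` limit after the shifts `t ↦ t + s_n`: an eternal classical solution with Lagrangian data,
  energy `≤ E₀`, affine FTLE mass bound and window floors `(a/2)·T` along `T = m + 1 → ∞`
  (Arzelà–Ascoli, limits of classical solutions, Picard–Lindelöf/Liouville, Grönwall, log-continuity).
Both are known-type analysis; no open input.
-/

open MeasureTheory Filter Topology Set

noncomputable section

namespace Summit.AnomalousDissipation.AnomalousDissipation.Cruxes.KolmogorovHorizonChaos.SplitWindowCapture.EternalisationBirth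

/-- Piece Fl, verbatim (split child 3/3). -/
def FloorEternalisation : Prop :=
  ∀ (ν : ℝ) (f : UnitAddTorus (Fin 3) → EuclideanSpace ℝ (Fin 3)) (τ E₀ L₀ a : ℝ) (B : ℕ → ℝ),
    0 < ν → Literature.Analysis.FunctionSpaces.Torus.IsSmooth f → 0 < τ →
    (∀ L : ℝ, L₀ ≤ L →
      ∃ (u : ℝ → UnitAddTorus (Fin 3) → EuclideanSpace ℝ (Fin 3)) (p : ℝ → UnitAddTorus (Fin 3) → ℝ)
        (D : ℝ → ℝ → UnitAddTorus (Fin 3) → EuclideanSpace ℝ (Fin 3)) (J : ℝ → ℝ → UnitAddTorus (Fin 3) → (EuclideanSpace ℝ (Fin 3) →L[ℝ] EuclideanSpace ℝ (Fin 3))),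
        Literature.Analysis.FunctionSpaces.Torus.IsSmoothSpaceTimeOn Set.univ u ∧ Literature.Analysis.FunctionSpaces.Torus.IsSmoothSpaceTimeOn Set.univ p ∧
        (∀ t, Literature.Analysis.FunctionSpaces.Torus.IsDivFree (u t)) ∧
        Literature.Analysis.FunctionSpaces.Torus.IsClassicalNSSolutionOn (Set.Icc 0 (L + τ)) ν (fun _ => f) u p ∧
        ((∀ t x, D t t x = 0) ∧
          (∀ t s x, HasDerivAt (fun r => D t r x) (u s (x + Literature.Analysis.FunctionSpaces.Torus.proj (D t s x))) s) ∧
          (∀ t x, J t t x = ContinuousLinearMap.id ℝ (EuclideanSpace ℝ (Fin 3))) ∧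
          (∀ t s x, HasDerivAt (fun r => J t r x) ((Literature.Analysis.FunctionSpaces.Torus.fderiv (u s) (x + Literature.Analysis.FunctionSpaces.Torus.proj (D t s x))).comp (J t s x)) s) ∧
          (∀ t s, MeasureTheory.MeasurePreserving (fun x : UnitAddTorus (Fin 3) => x + Literature.Analysis.FunctionSpaces.Torus.proj (D t s x)) MeasureTheory.volume MeasureTheory.volume) ∧
          Continuous (fun q : ℝ × ℝ × UnitAddTorus (Fin 3) => (D q.1 q.2.1 q.2.2, J q.1 q.2.1 q.2.2))) ∧
        (∀ t ∈ Set.Icc 0 (L + τ), MeasureTheory.integral MeasureTheory.volume (fun x : UnitAddTorus (Fin 3) => ‖u t x‖ ^ 2) ≤ E₀) ∧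
        (∀ k : ℕ, ∀ q ∈ (Set.Icc 0 (L + τ)) ×ˢ (Set.univ : Set (EuclideanSpace ℝ (Fin 3))),
          ‖iteratedFDeriv ℝ k (Literature.Analysis.FunctionSpaces.Torus.stLift u) q‖ ≤ B k ∧ ‖iteratedFDeriv ℝ k (Literature.Analysis.FunctionSpaces.Torus.stLift p) q‖ ≤ B k) ∧
        a * L ≤ ∫ t in (0 : ℝ)..L, MeasureTheory.integral MeasureTheory.volume
          (fun x : UnitAddTorus (Fin 3) => (τ⁻¹ * Real.log ‖J t (t + τ) x‖) ^ 2)) →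
    ∃ (u : ℝ → UnitAddTorus (Fin 3) → EuclideanSpace ℝ (Fin 3)) (p : ℝ → UnitAddTorus (Fin 3) → ℝ)
      (D : ℝ → ℝ → UnitAddTorus (Fin 3) → EuclideanSpace ℝ (Fin 3)) (J : ℝ → ℝ → UnitAddTorus (Fin 3) → (EuclideanSpace ℝ (Fin 3) →L[ℝ] EuclideanSpace ℝ (Fin 3))),
      Literature.Analysis.FunctionSpaces.Torus.IsClassicalNSSolutionOn Set.univ ν (fun _ => f) u p ∧
      ((∀ t x, D t t x = 0) ∧
        (∀ t s x, HasDerivAt (fun r => D t r x) (u s (x + Literature.Analysis.FunctionSpaces.Torus.proj (D t s x))) s) ∧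
        (∀ t x, J t t x = ContinuousLinearMap.id ℝ (EuclideanSpace ℝ (Fin 3))) ∧
        (∀ t s x, HasDerivAt (fun r => J t r x) ((Literature.Analysis.FunctionSpaces.Torus.fderiv (u s) (x + Literature.Analysis.FunctionSpaces.Torus.proj (D t s x))).comp (J t s x)) s) ∧
        (∀ t s, MeasureTheory.MeasurePreserving (fun x : UnitAddTorus (Fin 3) => x + Literature.Analysis.FunctionSpaces.Torus.proj (D t s x)) MeasureTheory.volume MeasureTheory.volume) ∧
        Continuous (fun q : ℝ × ℝ × UnitAddTorus (Fin 3) => (D q.1 q.2.1 q.2.2, J q.1 q.2.1 q.2.2))) ∧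
      (∀ t, MeasureTheory.integral MeasureTheory.volume (fun x : UnitAddTorus (Fin 3) => ‖u t x‖ ^ 2) ≤ E₀) ∧
      (∃ Bd : ℝ, ∀ T : ℝ, 0 ≤ T → ∫ t in (0 : ℝ)..T, MeasureTheory.integral MeasureTheory.volume
          (fun x : UnitAddTorus (Fin 3) => (τ⁻¹ * Real.log ‖J t (t + τ) x‖) ^ 2) ≤ Bd * (T + 1)) ∧
      (∀ n : ℕ, ∃ T : ℝ, (n : ℝ) + 1 ≤ T ∧ a / 2 * T ≤ ∫ t in (0 : ℝ)..T, MeasureTheory.integral MeasureTheory.volume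
          (fun x : UnitAddTorus (Fin 3) => (τ⁻¹ * Real.log ‖J t (t + τ) x‖) ^ 2))

/-- STUB 1: good late starts (tiling lemma for Cesàro floors + window bookkeeping). -/
theorem stub_goodShiftedWitnesses :
    ∀ (ν : ℝ) (f : UnitAddTorus (Fin 3) → EuclideanSpace ℝ (Fin 3)) (τ E₀ L₀ a : ℝ) (B : ℕ → ℝ),
    0 < ν → Literature.Analysis.FunctionSpaces.Torus.IsSmooth f → 0 < τ →
    (∀ L : ℝ, L₀ ≤ L →
    ∃ (u : ℝ → UnitAddTorus (Fin 3) → EuclideanSpace ℝ (Fin 3)) (p : ℝ → UnitAddTorus (Fin 3) → ℝ)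
    (D : ℝ → ℝ → UnitAddTorus (Fin 3) → EuclideanSpace ℝ (Fin 3)) (J : ℝ → ℝ → UnitAddTorus (Fin 3) → (EuclideanSpace ℝ (Fin 3) →L[ℝ] EuclideanSpace ℝ (Fin 3))),
    Literature.Analysis.FunctionSpaces.Torus.IsSmoothSpaceTimeOn Set.univ u ∧ Literature.Analysis.FunctionSpaces.Torus.IsSmoothSpaceTimeOn Set.univ p ∧
    (∀ t, Literature.Analysis.FunctionSpaces.Torus.IsDivFree (u t)) ∧
    Literature.Analysis.FunctionSpaces.Torus.IsClassicalNSSolutionOn (Set.Icc 0 (L + τ)) ν (fun _ => f) u p ∧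
    ((∀ t x, D t t x = 0) ∧
    (∀ t s x, HasDerivAt (fun r => D t r x) (u s (x + Literature.Analysis.FunctionSpaces.Torus.proj (D t s x))) s) ∧
    (∀ t x, J t t x = ContinuousLinearMap.id ℝ (EuclideanSpace ℝ (Fin 3))) ∧
    (∀ t s x, HasDerivAt (fun r => J t r x) ((Literature.Analysis.FunctionSpaces.Torus.fderiv (u s) (x + Literature.Analysis.FunctionSpaces.Torus.proj (D t s x))).comp (J t s x)) s) ∧
    (∀ t s, MeasureTheory.MeasurePreserving (fun x : UnitAddTorus (Fin 3) => x + Literature.Analysis.FunctionSpaces.Torus.proj (D t s x)) MeasureTheory.volume MeasureTheory.volume) ∧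
    Continuous (fun q : ℝ × ℝ × UnitAddTorus (Fin 3) => (D q.1 q.2.1 q.2.2, J q.1 q.2.1 q.2.2))) ∧
    (∀ t ∈ Set.Icc 0 (L + τ), MeasureTheory.integral MeasureTheory.volume (fun x : UnitAddTorus (Fin 3) => ‖u t x‖ ^ 2) ≤ E₀) ∧
    (∀ k : ℕ, ∀ q ∈ (Set.Icc 0 (L + τ)) ×ˢ (Set.univ : Set (EuclideanSpace ℝ (Fin 3))),
    ‖iteratedFDeriv ℝ k (Literature.Analysis.FunctionSpaces.Torus.stLift u) q‖ ≤ B k ∧ ‖iteratedFDeriv ℝ k (Literature.Analysis.FunctionSpaces.Torus.stLift p) q‖ ≤ B k) ∧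
    a * L ≤ ∫ t in (0 : ℝ)..L, MeasureTheory.integral MeasureTheory.volume
    (fun x : UnitAddTorus (Fin 3) => (τ⁻¹ * Real.log ‖J t (t + τ) x‖) ^ 2)) →
    ∀ n : ℕ, ∃ (L s : ℝ),
    ∃ (u : ℝ → UnitAddTorus (Fin 3) → EuclideanSpace ℝ (Fin 3)) (p : ℝ → UnitAddTorus (Fin 3) → ℝ)
    (D : ℝ → ℝ → UnitAddTorus (Fin 3) → EuclideanSpace ℝ (Fin 3)) (J : ℝ → ℝ → UnitAddTorus (Fin 3) → (EuclideanSpace ℝ (Fin 3) →L[ℝ] EuclideanSpace ℝ (Fin 3))),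
    Literature.Analysis.FunctionSpaces.Torus.IsSmoothSpaceTimeOn Set.univ u ∧ Literature.Analysis.FunctionSpaces.Torus.IsSmoothSpaceTimeOn Set.univ p ∧
    (∀ t, Literature.Analysis.FunctionSpaces.Torus.IsDivFree (u t)) ∧
    Literature.Analysis.FunctionSpaces.Torus.IsClassicalNSSolutionOn (Set.Icc 0 (L + τ)) ν (fun _ => f) u p ∧
    ((∀ t x, D t t x = 0) ∧
    (∀ t s x, HasDerivAt (fun r => D t r x) (u s (x + Literature.Analysis.FunctionSpaces.Torus.proj (D t s x))) s) ∧
    (∀ t x, J t t x = ContinuousLinearMap.id ℝ (EuclideanSpace ℝ (Fin 3))) ∧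
    (∀ t s x, HasDerivAt (fun r => J t r x) ((Literature.Analysis.FunctionSpaces.Torus.fderiv (u s) (x + Literature.Analysis.FunctionSpaces.Torus.proj (D t s x))).comp (J t s x)) s) ∧
    (∀ t s, MeasureTheory.MeasurePreserving (fun x : UnitAddTorus (Fin 3) => x + Literature.Analysis.FunctionSpaces.Torus.proj (D t s x)) MeasureTheory.volume MeasureTheory.volume) ∧
    Continuous (fun q : ℝ × ℝ × UnitAddTorus (Fin 3) => (D q.1 q.2.1 q.2.2, J q.1 q.2.1 q.2.2))) ∧
    (∀ t ∈ Set.Icc 0 (L + τ), MeasureTheory.integral MeasureTheory.volume (fun x : UnitAddTorus (Fin 3) => ‖u t x‖ ^ 2) ≤ E₀) ∧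
    (∀ k : ℕ, ∀ q ∈ (Set.Icc 0 (L + τ)) ×ˢ (Set.univ : Set (EuclideanSpace ℝ (Fin 3))),
    ‖iteratedFDeriv ℝ k (Literature.Analysis.FunctionSpaces.Torus.stLift u) q‖ ≤ B k ∧ ‖iteratedFDeriv ℝ k (Literature.Analysis.FunctionSpaces.Torus.stLift p) q‖ ≤ B k) ∧
    (n : ℝ) ≤ s ∧ s + 2 * n + 2 ≤ L ∧
    ∀ m : ℕ, m ≤ n → a / 2 * ((m : ℝ) + 1) ≤ ∫ t in s..(s + ((m : ℝ) + 1)), MeasureTheory.integral MeasureTheory.volume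
    (fun x : UnitAddTorus (Fin 3) => (τ⁻¹ * Real.log ‖J t (t + τ) x‖) ^ 2) := by
  sorry

/-- STUB 2: eternal limit of the shifted witnesses (compactness at fixed viscosity). -/
theorem stub_eternalLimitOfShifts :
    ∀ (ν : ℝ) (f : UnitAddTorus (Fin 3) → EuclideanSpace ℝ (Fin 3)) (τ E₀ a : ℝ) (B : ℕ → ℝ),
    0 < ν → Literature.Analysis.FunctionSpaces.Torus.IsSmooth f → 0 < τ →
    (∀ n : ℕ, ∃ (L s : ℝ),
    ∃ (u : ℝ → UnitAddTorus (Fin 3) → EuclideanSpace ℝ (Fin 3)) (p : ℝ → UnitAddTorus (Fin 3) → ℝ)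
    (D : ℝ → ℝ → UnitAddTorus (Fin 3) → EuclideanSpace ℝ (Fin 3)) (J : ℝ → ℝ → UnitAddTorus (Fin 3) → (EuclideanSpace ℝ (Fin 3) →L[ℝ] EuclideanSpace ℝ (Fin 3))),
    Literature.Analysis.FunctionSpaces.Torus.IsSmoothSpaceTimeOn Set.univ u ∧ Literature.Analysis.FunctionSpaces.Torus.IsSmoothSpaceTimeOn Set.univ p ∧
    (∀ t, Literature.Analysis.FunctionSpaces.Torus.IsDivFree (u t)) ∧
    Literature.Analysis.FunctionSpaces.Torus.IsClassicalNSSolutionOn (Set.Icc 0 (L + τ)) ν (fun _ => f) u p ∧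
    ((∀ t x, D t t x = 0) ∧
    (∀ t s x, HasDerivAt (fun r => D t r x) (u s (x + Literature.Analysis.FunctionSpaces.Torus.proj (D t s x))) s) ∧
    (∀ t x, J t t x = ContinuousLinearMap.id ℝ (EuclideanSpace ℝ (Fin 3))) ∧
    (∀ t s x, HasDerivAt (fun r => J t r x) ((Literature.Analysis.FunctionSpaces.Torus.fderiv (u s) (x + Literature.Analysis.FunctionSpaces.Torus.proj (D t s x))).comp (J t s x)) s) ∧
    (∀ t s, MeasureTheory.MeasurePreserving (fun x : UnitAddTorus (Fin 3) => x + Literature.Analysis.FunctionSpaces.Torus.proj (D t s x)) MeasureTheory.volume MeasureTheory.volume) ∧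
    Continuous (fun q : ℝ × ℝ × UnitAddTorus (Fin 3) => (D q.1 q.2.1 q.2.2, J q.1 q.2.1 q.2.2))) ∧
    (∀ t ∈ Set.Icc 0 (L + τ), MeasureTheory.integral MeasureTheory.volume (fun x : UnitAddTorus (Fin 3) => ‖u t x‖ ^ 2) ≤ E₀) ∧
    (∀ k : ℕ, ∀ q ∈ (Set.Icc 0 (L + τ)) ×ˢ (Set.univ : Set (EuclideanSpace ℝ (Fin 3))),
    ‖iteratedFDeriv ℝ k (Literature.Analysis.FunctionSpaces.Torus.stLift u) q‖ ≤ B k ∧ ‖iteratedFDeriv ℝ k (Literature.Analysis.FunctionSpaces.Torus.stLift p) q‖ ≤ B k) ∧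
    (n : ℝ) ≤ s ∧ s + 2 * n + 2 ≤ L ∧
    ∀ m : ℕ, m ≤ n → a / 2 * ((m : ℝ) + 1) ≤ ∫ t in s..(s + ((m : ℝ) + 1)), MeasureTheory.integral MeasureTheory.volume
    (fun x : UnitAddTorus (Fin 3) => (τ⁻¹ * Real.log ‖J t (t + τ) x‖) ^ 2)) →
    ∃ (u : ℝ → UnitAddTorus (Fin 3) → EuclideanSpace ℝ (Fin 3)) (p : ℝ → UnitAddTorus (Fin 3) → ℝ)
    (D : ℝ → ℝ → UnitAddTorus (Fin 3) → EuclideanSpace ℝ (Fin 3)) (J : ℝ → ℝ → UnitAddTorus (Fin 3) → (EuclideanSpace ℝ (Fin 3) →L[ℝ] EuclideanSpace ℝ (Fin 3))),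
    Literature.Analysis.FunctionSpaces.Torus.IsClassicalNSSolutionOn Set.univ ν (fun _ => f) u p ∧
    ((∀ t x, D t t x = 0) ∧
    (∀ t s x, HasDerivAt (fun r => D t r x) (u s (x + Literature.Analysis.FunctionSpaces.Torus.proj (D t s x))) s) ∧
    (∀ t x, J t t x = ContinuousLinearMap.id ℝ (EuclideanSpace ℝ (Fin 3))) ∧
    (∀ t s x, HasDerivAt (fun r => J t r x) ((Literature.Analysis.FunctionSpaces.Torus.fderiv (u s) (x + Literature.Analysis.FunctionSpaces.Torus.proj (D t s x))).comp (J t s x)) s) ∧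
    (∀ t s, MeasureTheory.MeasurePreserving (fun x : UnitAddTorus (Fin 3) => x + Literature.Analysis.FunctionSpaces.Torus.proj (D t s x)) MeasureTheory.volume MeasureTheory.volume) ∧
    Continuous (fun q : ℝ × ℝ × UnitAddTorus (Fin 3) => (D q.1 q.2.1 q.2.2, J q.1 q.2.1 q.2.2))) ∧
    (∀ t, MeasureTheory.integral MeasureTheory.volume (fun x : UnitAddTorus (Fin 3) => ‖u t x‖ ^ 2) ≤ E₀) ∧
    (∃ Bd : ℝ, ∀ T : ℝ, 0 ≤ T → ∫ t in (0 : ℝ)..T, MeasureTheory.integral MeasureTheory.volume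
    (fun x : UnitAddTorus (Fin 3) => (τ⁻¹ * Real.log ‖J t (t + τ) x‖) ^ 2) ≤ Bd * (T + 1)) ∧
    (∀ n : ℕ, ∃ T : ℝ, (n : ℝ) + 1 ≤ T ∧ a / 2 * T ≤ ∫ t in (0 : ℝ)..T, MeasureTheory.integral MeasureTheory.volume
    (fun x : UnitAddTorus (Fin 3) => (τ⁻¹ * Real.log ‖J t (t + τ) x‖) ^ 2)) := by
  sorry

/-- Composition (no sorry outside the stubs). -/
theorem FloorEternalisation_of : FloorEternalisation := by
  intro ν f τ E₀ L₀ a B hν hf hτ hyp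
  exact stub_eternalLimitOfShifts ν f τ E₀ a B hν hf hτ (stub_goodShiftedWitnesses ν f τ E₀ L₀ a B hν hf hτ hyp)

end Summit.AnomalousDissipation.AnomalousDissipation.Cruxes.KolmogorovHorizonChaos.SplitWindowCapture.EternalisationBirth

end
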